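import Summits.CriticalPhenomena.PercolationContinuityZ3.Theorems.PercNearOneGluingNoHeavyLowerTailMajorityGluingQCertSymParts
import HarnessLib

/-!
# Symmetrised DEGREE-3 certificates (cubic orbit keys): the language and the kernel check (lane prim-rate, constants-miner 1, gen 36; CANDIDATES §GEN-36 R344, NEXT-g37 item 1)

Support file for the closed crux `NoHeavyLowerTail` (stmt-CriticalPhenomena-4575), majority-gluing line.  The cubic analogue of `…MajorityGluingQCertSym`: the chain-free
degree-3 certificate language of `…MajorityGluingQCert3` (quadratic multiplier `ℓ₂ = Σ n·x_a x_b` of the conclusion, marginal slacks `(x_D − m_x)·x_a x_b`, hub-rooted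
van den Berg–Kahn rows times a variable `x_t`, squares times `x_t`) checked UP TO RELABELLING of the `m` relays: every contribution `z·x_i x_j x_k` is filed under the
ORBIT KEY `keyS3 m i j k` — the three indices are first ORIENTED by the relabelling-invariant statistic `(|i|, |i∩j| + |i∩k|)` (`orient3`; ties are symmetries), then
relabelled canonically by sorting the relays by their 3-bit membership class (`classList3`, `unrank3`, `pull`) — and `SymCert3.checkQ3S` asks that every key class has a
nonnegative coefficient sum.  This file: `classList3`/`unrank3`/`canon3`/`orient3`/`keyS3`, the structure `SymCert3`, `contribs3S`, `checkW3S`, `checkQ3S`, the cubic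
symmetrised moments `Msym3`, the key valuation `valS3`, the canonical relabelling as a permutation `classPerm3`; soundness in `…QCertSym3Sound` / `…QCertSym3Perm` /
`…QCertSym3Count`.  The symmetrised degree-3 moment LP reaches the programme values of the small cells ((3,2): 9/8; (4,3): ≈ 256/243; (6,4): ≤ 1.129, trigger 1.127),
so the `(6,4)` cell lands near `113/100` with a handful of row orbits (`C(8) ≈ 2.13`).  No sorries.
-/

namespace Summit.CriticalPhenomena.PercolationContinuityZ3.Theorems

namespace HubOnly
namespace QCert

/-! ### The canonical relabelling of an ordered triple and the orbit key of a cubic monomial -/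

/-- The relays `x < m` sorted STABLY by their 3-bit membership class w.r.t. `(i, j, k)` (class `4[x∈i] + 2[x∈j] + [x∈k]`, descending). -/
def classList3 (m i j k : ℕ) : List ℕ :=
  let l := List.range m
  let li := l.filter fun x => tb i x
  let ln := l.filter fun x => !(tb i x)
  let lij := li.filter fun x => tb j x
  let lin := li.filter fun x => !(tb j x)
  let lnj := ln.filter fun x => tb j x
  let lnn := ln.filter fun x => !(tb j x)
  (lij.filter fun x => tb k x) ++ ((lij.filter fun x => !(tb k x)) ++ ((lin.filter fun x => tb k x) ++ ((lin.filter fun x => !(tb k x)) ++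
    ((lnj.filter fun x => tb k x) ++ ((lnj.filter fun x => !(tb k x)) ++ ((lnn.filter fun x => tb k x) ++ (lnn.filter fun x => !(tb k x))))))))

/-- The canonical relabelling of the ordered triple `(i, j, k)` as a function on `ℕ`. -/
def unrank3 (m i j k : ℕ) (p : ℕ) : ℕ := (classList3 m i j k).getD p p

/-- The code (base `N = 2^m + 1`) of the canonical form of the ORDERED triple `(i, j, k)`. -/
def canon3 (m i j k : ℕ) : ℕ :=
  enc3 (2 ^ m + 1) (pull m (unrank3 m i j k) i, pull m (unrank3 m i j k) j, pull m (unrank3 m i j k) k)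

/-- The orientation statistic of the slot `i` in the triple `(i, j, k)`: `(|i|, |i∩j| + |i∩k|)` encoded as one number (relabelling-invariant; symmetric in `j, k`). -/
def tstat (m i j k : ℕ) : ℕ := (2 * m + 1) * popc m i + (popc m (i &&& j) + popc m (i &&& k))

/-- `(i, j, k)` reordered so that the orientation statistics are non-increasing (a fixed 3-element sorting network). -/
def orient3 (m i j k : ℕ) : ℕ × ℕ × ℕ :=
  let si := tstat m i j k
  let sj := tstat m j i k
  let sk := tstat m k i j
  if sj ≤ si then
    (if sk ≤ sj then (i, j, k) else if sk ≤ si then (i, k, j) else (k, i, j))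
  else
    (if sk ≤ si then (j, i, k) else if sk ≤ sj then (j, k, i) else (k, j, i))

/-- **The orbit key of the cubic monomial `x_i x_j x_k`**: the canonical code of the oriented triple. -/
def keyS3 (m i j k : ℕ) : ℕ :=
  let o := orient3 m i j k
  canon3 m o.1 o.2.1 o.2.2

/-! ### The certificates -/

/-- A symmetrised degree-3 certificate: cell parameters in `base` (lists and `fam` ignored), the quadratic multiplier `ell2` (`(a, b, n)`: `n·(cN x_D − cD T)·x_a x_b`),
marginal slacks `lin` (`(x, a, b, n)`: `n·(x_D − m_x)·x_a x_b`), rows times variables and squares times variables (chunked; one representative per orbit suffices). -/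
structure SymCert3 where
  /-- `m, h, cN, cD` -/
  base : Cert
  /-- `(a, b, n)`: `n·(cN·x_D − cD·T)·x_a·x_b` -/
  ell2 : List (ℕ × ℕ × ℕ)
  /-- `(x, a, b, n)`: `n·(x_D − m_x)·x_a·x_b` -/
  lin : List (ℕ × ℕ × ℕ × ℕ)
  /-- rows times variables, chunked -/
  rows : List (List RowE3)
  /-- squares times variables, chunked -/
  sqs : List (List SqE3)

namespace SymCert3

variable (c : SymCert3)

/-- Number of variables. -/
abbrev NV : ℕ := c.base.NV

/-- The key of `x_i x_j x_k` for this certificate's `m`. -/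
abbrev key (i j k : ℕ) : ℕ := keyS3 c.base.m i j k

/-- Contributions of an `ell2` entry (LHS, positive): `n·cN` at `x_D x_a x_b`, `−n·cD` at `x_i x_a x_b` for `i ∈ T`. -/
def ell2C (e : ℕ × ℕ × ℕ) : List (ℕ × ℤ) :=
  (c.key c.base.D e.1 e.2.1, (e.2.2 : ℤ) * c.base.cN) :: (suppOf c.NV c.base.tMem).map fun i => (c.key i e.1 e.2.1, -((e.2.2 : ℤ) * c.base.cD))

/-- Contributions of a marginal slack (RHS, entered negated): `−n` at `x_D x_a x_b`, `+n` at `x_i x_a x_b` for `i ∋ x`. -/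
def linC3 (e : ℕ × ℕ × ℕ × ℕ) : List (ℕ × ℤ) :=
  (c.key c.base.D e.2.1 e.2.2.1, -(e.2.2.2 : ℤ)) :: (suppOf c.NV (c.base.margMem e.1)).map fun i => (c.key i e.2.1 e.2.2.1, (e.2.2.2 : ℤ))

/-- Contributions of the product of two mask forms times `x_t`, with coefficient `z`. -/
def prodC3S (m1 m2 t : ℕ) (z : ℤ) : List (ℕ × ℤ) :=
  ((suppOf c.NV (tb m1)).map fun i => (suppOf c.NV (tb m2)).map fun j => (c.key i j t, z)).flatten

/-- Contributions of a row times `x_t` (RHS, negated): `−n` on `f₃⊗f₄·x_t`, `+n` on `f₁⊗f₂·x_t`. -/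
def rowC3S (r : RowE3) : List (ℕ × ℤ) := c.prodC3S r.row.m3 r.row.m4 r.t (-(r.row.n : ℤ)) ++ c.prodC3S r.row.m1 r.row.m2 r.t (r.row.n : ℤ)

/-- Contributions of a square times `x_t` (RHS, negated): `−n·u_i·u_j` at `x_i x_j x_t` over the support of `u`. -/
def sqC3S (s : SqE3) : List (ℕ × ℤ) :=
  ((suppOf c.NV (tb (s.sq.m1 ||| s.sq.m2))).map fun i =>
    (suppOf c.NV (tb (s.sq.m1 ||| s.sq.m2))).map fun j => (c.key i j s.t, -((s.sq.n : ℤ) * s.sq.u i * s.sq.u j))).flatten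

/-- **All contributions** (LHS positive, RHS negative), filed under cubic orbit keys. -/
def contribs3S : List (ℕ × ℤ) :=
  (c.ell2.map c.ell2C).flatten ++ (c.lin.map c.linC3).flatten ++
    (c.rows.map fun ch => (ch.map c.rowC3S).flatten).flatten ++ (c.sqs.map fun ch => (ch.map c.sqC3S).flatten).flatten

/-- The `δ²`-weight of `ℓ₂`. -/
def ell2DDS : ℕ := (c.ell2.map fun e => if e.1 = c.base.D ∧ e.2.1 = c.base.D then e.2.2 else 0).sum

/-- **The structural check**: `cD > 0`, `h ≥ 1`, `ℓ₂[δ²] > 0`, index ranges, rows well formed. -/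
def checkW3S : Bool :=
  decide (0 < c.base.cD) && decide (1 ≤ c.base.h) && decide (0 < c.ell2DDS) &&
    c.ell2.all (fun e => decide (e.1 < c.NV) && decide (e.2.1 < c.NV)) &&
    c.lin.all (fun e => decide (e.1 < c.base.m) && decide (e.2.1 < c.NV) && decide (e.2.2.1 < c.NV)) &&
    c.rows.all (fun ch => ch.all fun r => c.base.rowOK r.row && decide (r.t < c.NV)) &&
    c.sqs.all (fun ch => ch.all fun s => decide (s.t < c.NV))

/-- **The key check**: sort all contributions by orbit key and scan the runs. -/
def checkQ3S (fuel : ℕ) : Bool := runsOK (msort2 fuel c.contribs3S)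

/-- **The full check.** -/
def check3S (fuel : ℕ) : Bool := c.checkW3S && c.checkQ3S fuel

end SymCert3

/-! ### Objects of the soundness proof -/

section SoundnessObjects3

variable {G : Type*} [Fintype G]

/-- The symmetrised third moment `Σ_g v_g(i)·v_g(j)·v_g(k)` of a finite family of points. -/
noncomputable def Msym3 (v : G → ℕ → ℝ) (i j k : ℕ) : ℝ := ∑ g, v g i * v g j * v g k

/-- `Msym3` is nonnegative for nonnegative points. -/
theorem Msym3_nonneg (v : G → ℕ → ℝ) (hv : ∀ g i, 0 ≤ v g i) (i j k : ℕ) : 0 ≤ Msym3 v i j k :=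
  Finset.sum_nonneg fun g _ => mul_nonneg (mul_nonneg (hv g i) (hv g j)) (hv g k)

/-- `Msym3` is invariant under the six orderings of its indices. -/
theorem Msym3_perm (v : G → ℕ → ℝ) (i j k : ℕ) :
    Msym3 v i k j = Msym3 v i j k ∧ Msym3 v j i k = Msym3 v i j k ∧ Msym3 v j k i = Msym3 v i j k ∧
      Msym3 v k i j = Msym3 v i j k ∧ Msym3 v k j i = Msym3 v i j k := by
  unfold Msym3
  refine ⟨?_, ?_, ?_, ?_, ?_⟩ <;> exact Finset.sum_congr rfl fun g _ => by ring

/-- The cubic key valuation: `key = c + N(b + N a) ↦ Msym3 v a b c`. -/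
noncomputable def valS3 (v : G → ℕ → ℝ) (N key : ℕ) : ℝ := Msym3 v (key / N / N) (key / N % N) (key % N)

/-- `valS3` is nonnegative for nonnegative points. -/
theorem valS3_nonneg (v : G → ℕ → ℝ) (hv : ∀ g i, 0 ≤ v g i) (N key : ℕ) : 0 ≤ valS3 v N key := Msym3_nonneg v hv _ _ _

end SoundnessObjects3

/-! ### The canonical relabelling of a triple is a permutation -/

/-- A binary split by a Boolean test is a permutation. -/
theorem filter_split_perm (p : ℕ → Bool) (l : List ℕ) : (l.filter p ++ l.filter fun x => !(p x)).Perm l := List.filter_append_perm _ _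

/-- `classList3 m i j k` is a permutation of `range m`. -/
theorem classList3_perm (m i j k : ℕ) : (classList3 m i j k).Perm (List.range m) := by
  unfold classList3
  simp only []
  set l := List.range m
  set li := l.filter fun x => tb i x
  set ln := l.filter fun x => !(tb i x)
  set lij := li.filter fun x => tb j x
  set lin := li.filter fun x => !(tb j x)
  set lnj := ln.filter fun x => tb j x
  set lnn := ln.filter fun x => !(tb j x)
  have h1 : (lnn.filter (fun x => tb k x) ++ lnn.filter (fun x => !(tb k x))).Perm lnn := filter_split_perm _ _
  have h2 : (lnj.filter (fun x => tb k x) ++ (lnj.filter (fun x => !(tb k x)) ++ (lnn.filter (fun x => tb k x) ++ lnn.filter (fun x => !(tb k x))))).Perm ln := by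
    have := (List.Perm.append_left (lnj.filter fun x => !(tb k x)) h1)
    have h' := (List.Perm.append_left (lnj.filter fun x => tb k x) this)
    refine h'.trans ?_
    rw [← List.append_assoc]
    exact ((filter_split_perm _ lnj).append (List.Perm.refl lnn)).trans (filter_split_perm _ ln)
  have h3 : (lin.filter (fun x => tb k x) ++ (lin.filter (fun x => !(tb k x)) ++ (lnj.filter (fun x => tb k x) ++ (lnj.filter (fun x => !(tb k x)) ++
      (lnn.filter (fun x => tb k x) ++ lnn.filter (fun x => !(tb k x))))))).Perm (lin ++ ln) := by
    have := List.Perm.append_left (lin.filter fun x => !(tb k x)) h2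
    have h' := List.Perm.append_left (lin.filter fun x => tb k x) this
    refine h'.trans ?_
    rw [← List.append_assoc]
    exact (filter_split_perm _ lin).append (List.Perm.refl ln)
  have h4 : (lij.filter (fun x => tb k x) ++ (lij.filter (fun x => !(tb k x)) ++ (lin.filter (fun x => tb k x) ++ (lin.filter (fun x => !(tb k x)) ++
      (lnj.filter (fun x => tb k x) ++ (lnj.filter (fun x => !(tb k x)) ++ (lnn.filter (fun x => tb k x) ++ lnn.filter (fun x => !(tb k x))))))))).Perm
      (lij ++ (lin ++ ln)) := by
    have := List.Perm.append_left (lij.filter fun x => !(tb k x)) h3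
    have h' := List.Perm.append_left (lij.filter fun x => tb k x) this
    refine h'.trans ?_
    rw [← List.append_assoc]
    exact (filter_split_perm _ lij).append (List.Perm.refl _)
  refine h4.trans ?_
  rw [← List.append_assoc]
  exact ((filter_split_perm _ li).append (List.Perm.refl ln)).trans (filter_split_perm _ l)

/-- Length `m`. -/
theorem classList3_length (m i j k : ℕ) : (classList3 m i j k).length = m := by
  rw [(classList3_perm m i j k).length_eq, List.length_range]

/-- Entries `< m`. -/
theorem classList3_getElem_lt (m i j k : ℕ) (p : ℕ) (hp : p < (classList3 m i j k).length) : (classList3 m i j k)[p] < m :=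
  List.mem_range.1 ((classList3_perm m i j k).mem_iff.1 (List.getElem_mem hp))

/-- The canonical relabelling on `Fin m`. -/
def classFun3 (m i j k : ℕ) (p : Fin m) : Fin m :=
  ⟨(classList3 m i j k)[p.1]'(by rw [classList3_length]; exact p.2), classList3_getElem_lt m i j k _ _⟩

/-- It is injective. -/
theorem classFun3_injective (m i j k : ℕ) : Function.Injective (classFun3 m i j k) := by
  intro p q h
  have h' : (classList3 m i j k)[p.1]'(by rw [classList3_length]; exact p.2) = (classList3 m i j k)[q.1]'(by rw [classList3_length]; exact q.2) :=
    congrArg Fin.val h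
  exact Fin.ext (((classList3_perm m i j k).nodup_iff.2 List.nodup_range).getElem_inj_iff.1 h')

/-- **The canonical relabelling of a triple as a permutation of `Fin m`.** -/
noncomputable def classPerm3 (m i j k : ℕ) : Equiv.Perm (Fin m) :=
  Equiv.ofBijective (classFun3 m i j k) (Finite.injective_iff_bijective.1 (classFun3_injective m i j k))

/-! ### Smoke test: `(2,1)` at `c = 2` with the quadratic multiplier `x_D²` -/

/-- `(2,1)`, `c = 2`: `(2x_D − T)·x_D² = ((x_D − m_0) + (x_D − m_1) + x_{11})·x_D²`. -/
def sym3Smoke : SymCert3 := ⟨⟨2, 1, 2, 1, 1, [], [], []⟩, [(4, 4, 1)], [(0, 4, 4, 1), (1, 4, 4, 1)], [], []⟩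

/-- The smoke certificate passes. -/
theorem sym3Smoke_check : sym3Smoke.check3S 8 = true := by decide +kernel

/-- Cubic orbit keys identify relabelled and reordered triples, e.g. `{x_01, x_01, x_10} ~ {x_01, x_10, x_10}` by `0 ↔ 1` (`m = 2`, `D = 4`). -/
theorem keyS3_examples : keyS3 2 1 2 4 = keyS3 2 2 1 4 ∧ keyS3 2 4 1 2 = keyS3 2 1 2 4 ∧ keyS3 2 3 1 1 = keyS3 2 2 3 2 ∧ keyS3 2 1 1 2 = keyS3 2 1 2 2 ∧
    keyS3 2 1 1 1 ≠ keyS3 2 1 1 2 := by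
  decide +kernel

end QCert
end HubOnly

end Summit.CriticalPhenomena.PercolationContinuityZ3.Theorems
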